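import Literature.AnabelianGeometry.AbsoluteAnabelian.AbsTopII.Remark332Proofs
import Literature.AnabelianGeometry.AbsoluteAnabelian.AbsAnabResidueCardProofs
import Literature.AnabelianGeometry.AbsoluteAnabelian.MLFGaloisGroupsFactsProofs
import HarnessLib

/-!
# [AbsTopI] Theorem 2.14 (i), group-theoretic part — kernel-checked relative to Thm 2.6 (ii), (v)

S. Mochizuki, *Topics in Absolute Anabelian Geometry I: Generalities* [AbsTopI], Theorem 2.14 (i)
p. 33 (manuscript pagination, lit key `paper:url-11ac98ba15fc`; bib key `MochizukiAbsTopI2012`):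
"For `i = 1, 2`, let `1 → Δᵢ → Πᵢ → Gᵢ → 1`, `kᵢ`, `Xᵢ`, `Σᵢ`, `φ : Π₁ → Π₂` be as in Proposition
2.5.  Suppose further that `kᵢ` is an MLF of residue characteristic `pᵢ`; that `Σᵢ` contains a
prime `≠ pᵢ`; that `φ` is an isomorphism; and that `Xᵢ` is a hyperbolic curve with stable reduction
[...]. Then: (i) We have `p₁ = p₂`, `Σ₁ = Σ₂`; `φ` induces isomorphisms `Δ₁ ⥲ Δ₂`, `G₁ ⥲ G₂`;
[...]".  abc-iut-L4-t4 typed this group-theoretic part as the predicate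
`FundamentalExtension.Thm214GroupPart B₁ B₂ φ` (`AbsTopISemiAbsolute.lean`), reading "`Σᵢ`" as
in the printed proof p. 33 ("`Σᵢ` is the unique minimal `Σ ⊆ Primes` such that `Δᵢ` is almost
pro-`Σ`").

In print the group part is deduced from Corollary 2.8 (ii) ("By Corollary 2.8, (ii), `p₁ = p₂`,
and `φ` induces isomorphisms `Δ₁ ⥲ Δ₂`, `G₁ ⥲ G₂`", proof p. 33); Cor 2.8 is not typed in the
tree (not cited by [IUTchI–IV]).  This proof-only file (no new definitions) derives the same
conclusion from the two [AbsTopI] Thm 2.6 inputs that ARE typed (abc-iut-L4-t4), which is the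
route [AbsTopII] Rmk 3.3.2 names for the group-theoreticity of `Δ ⊆ Π`:

* `FundamentalExtension.Thm26v Bᵢ` on both sides ([AbsTopI] Thm 2.6 (v), the `ζ`-intersection
  characterization of `Δ`, case `Θ = {1}`) ⟹ `φ(Δ₁) = Δ₂` (`preservesGeom_of_thm26v`,
  abc-iut-L4-t6 `AbsTopII/Remark332Proofs.lean`) ⟹ a bicontinuous `G₁ ⥲ G₂`
  (`PreservesGeom.exists_continuousMulEquiv_gal`) and a bicontinuous `Δ₁ ⥲ Δ₂`;
* `FundamentalExtension.thm26_ii_delta_gal` ([AbsTopI] Thm 2.6 (ii) rank formula, giving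
  [AbsAnab] Prop 1.2.1 (i) as `galoisMLF_iso_residueChar_eq_of_delta`) ⟹ `p₁ = p₂`;
* equality of the minimal almost-pro sets: almost pro-`Σ`-ness ([AbsTopI] Def 1.1 (iii): "If `G`
  admits an open subgroup which is pro-`Σ`, then we shall say that `G` is almost pro-`Σ`") is
  transported along the induced `Δ₁ ⥲ Δ₂` (`IsProSet.of_continuousMulEquiv`,
  `IsAlmostPro.of_continuousMulEquiv`, PROVED) — unconditionally given `φ(Δ₁) = Δ₂`.

Main statement: `FundamentalExtension.thm214GroupPart_of_thm26v_of_delta`; the intermediate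
`thm214GroupPart_of_preservesGeom` needs only `φ(Δ₁) = Δ₂` and [AbsAnab] Prop 1.2.1 (i).  HONEST
FRAMING: a reduction of a refereed statement to named typed inputs (`Thm26v`,
`thm26_ii_delta_gal`) by a route differing from the printed one (Cor 2.8 (ii)); the
scheme-theoretic hypotheses of Thm 2.14 (stable reduction, the `Σᵢ`-conditions) and its semi-graph
parts are not touched; nothing here bears on [IUTchIII] Cor 3.12.
-/

noncomputable section

open Topology

namespace Literature.AnabelianGeometry.AbsoluteAnabelian

universe u

/-! ### Transport of (almost) pro-`Σ`-ness along isomorphisms of topological groups -/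

section Transport

variable {A B : Type u} [Group A] [TopologicalSpace A] [Group B] [TopologicalSpace B]

/-- Membership in the image subgroup along `φ` is membership of `φ⁻¹ y`. [folklore] -/
private theorem mem_map_iff_symm_mem (φ : A ≃ₜ* B) (N : Subgroup A) (y : B) :
    y ∈ N.map φ.toMulEquiv.toMonoidHom ↔ φ.symm y ∈ N := by
  constructor
  · rintro ⟨x, hx, rfl⟩
    change φ.symm (φ x) ∈ N
    rwa [φ.symm_apply_apply]
  · intro h
    exact ⟨φ.symm y, h, φ.apply_symm_apply y⟩

/-- The underlying set of the image subgroup along `φ` is the image set. [folklore] -/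
private theorem coe_map_eq_image (φ : A ≃ₜ* B) (N : Subgroup A) :
    ((N.map φ.toMulEquiv.toMonoidHom : Subgroup B) : Set B) = φ '' (N : Set A) := by
  ext y
  simp only [Subgroup.coe_map, Set.mem_image, SetLike.mem_coe]
  constructor
  · rintro ⟨x, hx, rfl⟩
    exact ⟨x, hx, rfl⟩
  · rintro ⟨x, hx, rfl⟩
    exact ⟨x, hx, rfl⟩

/-- A subgroup is bicontinuously isomorphic to its image along `φ` (existence form, no data
declared). [folklore] -/
private theorem nonempty_equiv_map (φ : A ≃ₜ* B) (N : Subgroup A) :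
    Nonempty (N ≃ₜ* (N.map φ.toMulEquiv.toMonoidHom : Subgroup B)) := by
  refine ⟨{ toFun := fun x => ⟨φ x, ⟨x, x.2, rfl⟩⟩
            invFun := fun y => ⟨φ.symm y, (mem_map_iff_symm_mem φ N y).mp y.2⟩
            left_inv := fun x => Subtype.ext (φ.symm_apply_apply x)
            right_inv := fun y => Subtype.ext (φ.apply_symm_apply y)
            map_mul' := fun x y => Subtype.ext (map_mul φ (x : A) (y : A))
            continuous_toFun := ?_
            continuous_invFun := ?_ }⟩
  · exact (φ.continuous.comp continuous_subtype_val).subtype_mk _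
  · exact (φ.symm.continuous.comp continuous_subtype_val).subtype_mk _

/-- Equal subgroups are bicontinuously isomorphic (existence form; avoids dependent rewriting).
[folklore] -/
private theorem nonempty_equiv_of_subgroup_eq {H K : Subgroup A} (h : H = K) :
    Nonempty (H ≃ₜ* K) := by
  subst h
  exact ⟨ContinuousMulEquiv.refl _⟩

/-- **Pro-`Σ`-ness is an isomorphism invariant** ([AbsTopI] Def 1.1 (iii)): along `e : A ⥲ B`, an
open normal subgroup `U ⊆ B` pulls back to an open normal subgroup of `A` of the same index.
[cite: MochizukiAbsTopI2012, Def 1.1 (iii) p.10] -/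
theorem IsProSet.of_continuousMulEquiv (e : A ≃ₜ* B) {S : Set ℕ} (h : IsProSet A S) :
    IsProSet B S := by
  refine ⟨fun U hU hUopen q hq hdvd => ?_⟩
  have hnormal : (U.comap e.toMulEquiv.toMonoidHom).Normal := Subgroup.Normal.comap hU _
  have hopen : IsOpen ((U.comap e.toMulEquiv.toMonoidHom : Subgroup A) : Set A) :=
    hUopen.preimage e.continuous
  have hindex : (U.comap e.toMulEquiv.toMonoidHom).index = U.index :=
    Subgroup.index_comap_of_surjective U e.surjective
  exact h.prime_dvd_index _ hnormal hopen q hq (hindex ▸ hdvd)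

/-- Pro-`Σ`-ness is invariant under `≃ₜ*` (iff form). [cite: MochizukiAbsTopI2012, Def 1.1 (iii)
p.10] -/
theorem isProSet_congr (e : A ≃ₜ* B) (S : Set ℕ) : IsProSet A S ↔ IsProSet B S :=
  ⟨IsProSet.of_continuousMulEquiv e, IsProSet.of_continuousMulEquiv e.symm⟩

/-- **Almost pro-`Σ`-ness is an isomorphism invariant** ([AbsTopI] Def 1.1 (iii): "If `G` admits an
open subgroup which is pro-`Σ`, then we shall say that `G` is almost pro-`Σ`"): the image of a
pro-`Σ` open subgroup along `e : A ⥲ B` is a pro-`Σ` open subgroup. [cite: MochizukiAbsTopI2012, Def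
1.1 (iii) p.10] -/
theorem IsAlmostPro.of_continuousMulEquiv (e : A ≃ₜ* B) {S : Set ℕ} (h : IsAlmostPro A S) :
    IsAlmostPro B S := by
  obtain ⟨H, hHopen, hHpro⟩ := h.exists_open_pro
  refine ⟨⟨H.map e.toMulEquiv.toMonoidHom, ?_, ?_⟩⟩
  · rw [coe_map_eq_image]
    exact e.toHomeomorph.isOpenMap _ hHopen
  · obtain ⟨eH⟩ := nonempty_equiv_map e H
    exact hHpro.of_continuousMulEquiv eH

/-- Almost pro-`Σ`-ness is invariant under `≃ₜ*` (iff form).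
[cite: MochizukiAbsTopI2012, Def 1.1 (iii) p.10] -/
theorem isAlmostPro_congr (e : A ≃ₜ* B) (S : Set ℕ) : IsAlmostPro A S ↔ IsAlmostPro B S :=
  ⟨IsAlmostPro.of_continuousMulEquiv e, IsAlmostPro.of_continuousMulEquiv e.symm⟩

end Transport

namespace FundamentalExtension

/-! ### The induced isomorphism `Δ₁ ⥲ Δ₂` and the minimal almost-pro sets -/

section Geom

variable {E F : FundamentalExtension.{u}}

/-- "`φ` induces isomorphisms `Δ₁ ⥲ Δ₂`" (Thm 2.14 (i)): a `Δ`-preserving bicontinuous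
`φ : Π₁ ⥲ Π₂` restricts to a bicontinuous isomorphism `Δ₁ ⥲ Δ₂` (existence form).
[cite: MochizukiAbsTopI2012, Thm 2.14 (i) p.33] -/
theorem PreservesGeom.nonempty_continuousMulEquiv_geom {φ : E.arith ≃ₜ* F.arith}
    (hφ : PreservesGeom φ) : Nonempty (E.geom ≃ₜ* F.geom) := by
  obtain ⟨e₁⟩ := nonempty_equiv_map φ E.geom
  -- `E.geom.map φ = F.geom`; transport the target along this equality of subgroups
  obtain ⟨e₂⟩ := nonempty_equiv_of_subgroup_eq (A := F.arith) hφ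
  exact ⟨e₁.trans e₂⟩

/-- Along a `Δ`-preserving `φ : Π₁ ⥲ Π₂`, `Δ₁` is almost pro-`Σ'` iff `Δ₂` is.
[cite: MochizukiAbsTopI2012, Thm 2.14 (i) p.33] -/
theorem PreservesGeom.isAlmostPro_geom_iff {φ : E.arith ≃ₜ* F.arith} (hφ : PreservesGeom φ)
    (S : Set ℕ) : IsAlmostPro E.geom S ↔ IsAlmostPro F.geom S := by
  obtain ⟨e⟩ := hφ.nonempty_continuousMulEquiv_geom
  exact isAlmostPro_congr e S

/-- Equality of the minimal almost-pro sets, in the reading of the printed proof p. 33 ("`Σᵢ` is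
the unique minimal `Σ ⊆ Primes` such that `Δᵢ` is almost pro-`Σ`"): along a `Δ`-preserving `φ`, a
set is the minimal almost-pro set of `Δ₁` iff it is that of `Δ₂`.
[cite: MochizukiAbsTopI2012, Thm 2.14 (i) p.33] -/
theorem PreservesGeom.minimalAlmostPro_iff {φ : E.arith ≃ₜ* F.arith} (hφ : PreservesGeom φ)
    (S : Set ℕ) :
    (IsAlmostPro E.geom S ∧ ∀ S', IsAlmostPro E.geom S' → S ⊆ S') ↔
      (IsAlmostPro F.geom S ∧ ∀ S', IsAlmostPro F.geom S' → S ⊆ S') := by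
  have h := fun T => hφ.isAlmostPro_geom_iff T
  constructor
  · rintro ⟨hS, hmin⟩
    exact ⟨(h S).mp hS, fun S' hS' => hmin S' ((h S').mpr hS')⟩
  · rintro ⟨hS, hmin⟩
    exact ⟨(h S).mpr hS, fun S' hS' => hmin S' ((h S').mp hS')⟩

end Geom

/-! ### Theorem 2.14 (i), group-theoretic part -/

section Thm214

variable {E F : FundamentalExtension.{0}}

/-- "`p₁ = p₂`" (Thm 2.14 (i)) for a `Δ`-preserving `φ : Π₁ ⥲ Π₂` between extensions with MLF base
data, GIVEN [AbsAnab] Prop 1.2.1 (i) in its typed closed form `galoisMLF_iso_residueChar_eq`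
(applied to the induced bicontinuous `G_{K₁} ⥲ G_{K₂}`). [cite: MochizukiAbsTopI2012, Thm 2.14 (i)
p.33] -/
theorem PreservesGeom.residueChar_eq_of_residueChar_fact (h121 : galoisMLF_iso_residueChar_eq)
    (B₁ : E.MLFBase) (B₂ : F.MLFBase) {φ : E.arith ≃ₜ* F.arith} (hφ : PreservesGeom φ) :
    B₁.p = B₂.p := by
  letI := B₁.instPrime; letI := B₁.instField; letI := B₁.instAlgebra; letI := B₁.instFinite
  letI := B₂.instPrime; letI := B₂.instField; letI := B₂.instAlgebra; letI := B₂.instFinite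
  obtain ⟨β, -⟩ := hφ.exists_continuousMulEquiv_gal
  exact h121 B₁.p B₂.p B₁.K B₂.K ⟨(B₁.galIso.symm.trans β).trans B₂.galIso⟩

/-- Thm 2.14 (i), group part, from `φ(Δ₁) = Δ₂` and [AbsAnab] Prop 1.2.1 (i): once `φ` preserves
`Δ`, the three clauses "`p₁ = p₂`", "`φ` induces isomorphisms `Δ₁ ⥲ Δ₂`, `G₁ ⥲ G₂`" (typed:
`PreservesGeom φ`),
"`Σ₁ = Σ₂`" (minimal almost-pro sets) hold, GIVEN `galoisMLF_iso_residueChar_eq`.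
[cite: MochizukiAbsTopI2012, Thm 2.14 (i) p.33] -/
theorem thm214GroupPart_of_preservesGeom (h121 : galoisMLF_iso_residueChar_eq)
    (B₁ : E.MLFBase) (B₂ : F.MLFBase) {φ : E.arith ≃ₜ* F.arith} (hφ : PreservesGeom φ) :
    Thm214GroupPart B₁ B₂ φ :=
  ⟨hφ.residueChar_eq_of_residueChar_fact h121 B₁ B₂, hφ, fun S => hφ.minimalAlmostPro_iff S⟩

/-- **[AbsTopI] Thm 2.14 (i), group-theoretic part**, relative to the typed Thm 2.6 (ii), (v)
(print deduces it from Cor 2.8 (ii), not typed in the tree): for extensions `Π₁`, `Π₂` with MLF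
base data satisfying the typed Thm 2.6 (v) (`Thm26v`, the `ζ`-characterization of `Δ`) and GIVEN
the Thm 2.6 (ii) rank formula (`thm26_ii_delta_gal`, which yields [AbsAnab] Prop 1.2.1 (i)), EVERY
isomorphism of profinite groups `φ : Π₁ ⥲ Π₂` satisfies `Thm214GroupPart B₁ B₂ φ`: `p₁ = p₂`,
`φ(Δ₁) = Δ₂` (hence `Δ₁ ⥲ Δ₂`, `G₁ ⥲ G₂`), and equal minimal almost-pro sets.
[cite: MochizukiAbsTopI2012, Thm 2.14 (i) p.33] -/
theorem thm214GroupPart_of_thm26v_of_delta (hδ : thm26_ii_delta_gal) {B₁ : E.MLFBase}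
    {B₂ : F.MLFBase} (h₁ : E.Thm26v B₁) (h₂ : F.Thm26v B₂) (φ : E.arith ≃ₜ* F.arith) :
    Thm214GroupPart B₁ B₂ φ :=
  thm214GroupPart_of_preservesGeom (galoisMLF_iso_residueChar_eq_of_delta hδ) B₁ B₂
    (preservesGeom_of_thm26v h₁ h₂ φ)

/-- The induced bicontinuous `G₁ ⥲ G₂` of Thm 2.14 (i) under the same inputs (existence form,
compatible with the augmentations). [cite: MochizukiAbsTopI2012, Thm 2.14 (i) p.33] -/
theorem exists_continuousMulEquiv_gal_of_thm26v {B₁ : E.MLFBase} {B₂ : F.MLFBase}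
    (h₁ : E.Thm26v B₁) (h₂ : F.Thm26v B₂) (φ : E.arith ≃ₜ* F.arith) :
    ∃ β : E.gal ≃ₜ* F.gal, ∀ x : E.arith, β (E.aug x) = F.aug (φ x) :=
  (preservesGeom_of_thm26v h₁ h₂ φ).exists_continuousMulEquiv_gal

/-- The induced bicontinuous `Δ₁ ⥲ Δ₂` of Thm 2.14 (i) under the same inputs (existence form).
[cite: MochizukiAbsTopI2012, Thm 2.14 (i) p.33] -/
theorem nonempty_continuousMulEquiv_geom_of_thm26v {B₁ : E.MLFBase} {B₂ : F.MLFBase}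
    (h₁ : E.Thm26v B₁) (h₂ : F.Thm26v B₂) (φ : E.arith ≃ₜ* F.arith) :
    Nonempty (E.geom ≃ₜ* F.geom) :=
  (preservesGeom_of_thm26v h₁ h₂ φ).nonempty_continuousMulEquiv_geom

end Thm214

end FundamentalExtension

end Literature.AnabelianGeometry.AbsoluteAnabelian
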